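import Summits.HubbardSuperconductivity.HubbardSuperconductivity.Theorems.SsbToEvenTorusLro.Negative.SaturatedFerromagnet
import Literature.MathematicalPhysics.QuantumLattice.ReducedBCSTorus
import Literature.MathematicalPhysics.QuantumLattice.FreeFermiGasNoPairFieldLRO
import Literature.MathematicalPhysics.QuantumLattice.HubbardSzSectorLadder
import Literature.MathematicalPhysics.QuantumLattice.TorusCooperSum

/-!
# Crux `MesoscopicPairOrder` (item `stmt-HubbardSuperconductivity-7331`): the single spin flip against
# saturated ferromagnetism — flip-state algebra

Negative-side support (lead c7, line `pointwise_split`): the one rigorous instrument against the crux body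
at a point is the saturated-ferromagnet exclusion (`Negative/SaturatedExclusion.lean`,
`pointwise_false_of_saturated`: saturated `(N_L, S^z = 0)`-sector ground states infinitely often kill the
Fejér-box pair functional). This file and `NoSaturationWindow.lean` prove that the instrument CANNOT fire
on the route's coupling window: Tasaki's single-spin-flip instability of saturated ferromagnetism
(Prog. Theor. Phys. 99 (1998) 489, Thm 3.2: no saturated ground state for `0 ≤ U < ε_N - ε_1`), in its
Hartree form on the torus `(ℤ/Lℤ)²`.

Here: the FLIP STATE. For a vector `φ` of the fully polarised sector (`m + 1` up electrons, none down)
with `H φ = E φ` (`H = hubbardTorus 2 L 1 U`; on that sector `H` is the free band), an up Bloch mode `p`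
and the down Bloch mode of momentum `0` (band bottom `ε_L(0) = -4`), the vector
`χ = c†_{0↓} c_{p↑} φ` lies in the sector `(m, 1)`, has `‖χ‖ = ‖c_{p↑} φ‖`, kinetic energy
`(E - ε_L(p) - 4) ‖χ‖²` and interaction energy EXACTLY `U (m / L²) ‖χ‖²` (a delocalised down
electron meets the uniform up density `m/L²`): `re_expect_flipState`. Consequence
(`minEnergyOn_flipSector_le`): the sector energy of `(m, 1)` is at most `E - ε_L(p) - 4 + U m/L²`
whenever `c_{p↑} φ ≠ 0` (the choice of `p` — pigeonhole on the Bloch occupations — and the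
exclusion itself are in `NoSaturationWindow.lean`).

Sources: H. Tasaki, Prog. Theor. Phys. 99 (1998) 489, §3.2, Thm 3.2; B. S. Shastry,
H. R. Krishnamurthy, P. W. Anderson, Phys. Rev. B 41 (1990) 2375 (single-spin-flip instability of
the Nagaoka state); E. H. Lieb, PRL 62 (1989) 1201 (sectors). Folklore algebra; no definition, no
named fact.
-/

noncomputable section

-- the summit namespace repeats the problem name by design (D-0017)
set_option linter.dupNamespace false

namespace Summit.HubbardSuperconductivity.HubbardSuperconductivity.Theorems.MesoscopicPairOrder.Negative

open Matrix Finset Filter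
open Literature.Probability.LatticeModels Literature.MathematicalPhysics.QuantumLattice
open scoped ComplexOrder ComplexConjugate

variable {L : ℕ} [NeZero L]

/-! ### The free band commuted past Bloch modes -/

/-- `[n_{kσ}, c_{pτ}] = -δ c_{pτ}` in momentum space. [folklore] -/
theorem momentumNumber_mul_momentumAnnihilation (k p : TorusSite 2 L) (σ τ : Fin 2) :
    momentumNumber k σ * momentumAnnihilation p τ =
      momentumAnnihilation p τ * momentumNumber k σ -
        (if k = p ∧ σ = τ then momentumAnnihilation p τ else 0) := by
  have h1 : momentumCreation k σ * momentumAnnihilation p τ =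
      (if p = k ∧ τ = σ then 1 else 0) - momentumAnnihilation p τ * momentumCreation k σ := by
    rw [momentumAnnihilation_mul_momentumCreation p k τ σ]
    abel
  rw [momentumNumber, Matrix.mul_assoc, momentumAnnihilation_mul_eq_neg k p σ τ, Matrix.mul_neg,
    ← Matrix.mul_assoc, h1, Matrix.sub_mul, ite_mul, Matrix.one_mul, Matrix.zero_mul,
    Matrix.mul_assoc]
  by_cases h : k = p ∧ σ = τ
  · obtain ⟨rfl, rfl⟩ := h
    simp only [and_self, if_true]
    abel
  · have h' : ¬(p = k ∧ τ = σ) := fun h'' => h ⟨h''.1.symm, h''.2.symm⟩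
    rw [if_neg h, if_neg h']
    abel

/-- `[n_{kσ}, c†_{qτ}] = +δ c†_{qτ}` in momentum space. [folklore] -/
theorem momentumNumber_mul_momentumCreation (k q : TorusSite 2 L) (σ τ : Fin 2) :
    momentumNumber k σ * momentumCreation q τ =
      momentumCreation q τ * momentumNumber k σ +
        (if k = q ∧ σ = τ then momentumCreation q τ else 0) := by
  have h := congrArg conjTranspose (momentumNumber_mul_momentumAnnihilation k q σ τ)
  rw [conjTranspose_mul, conjTranspose_sub, conjTranspose_mul, momentumNumber_conjTranspose,
    momentumAnnihilation_conjTranspose] at h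
  -- h : c†_q * n_k = n_k * c†_q - (ite)ᴴ
  have hite : (if k = q ∧ σ = τ then momentumAnnihilation q τ else 0)ᴴ =
      (if k = q ∧ σ = τ then momentumCreation q τ else 0) := by
    split_ifs
    · exact momentumAnnihilation_conjTranspose q τ
    · exact conjTranspose_zero
  rw [hite] at h
  rw [h]
  abel

/-- The free band commuted past an up annihilator: `H₀ c_{p↑} = c_{p↑} H₀ - ε_L(p) c_{p↑}` (`L ≥ 3`).
[folklore] -/
theorem hubbardTorus_zero_mul_momentumAnnihilation (hL : 3 ≤ L) (p : TorusSite 2 L) (τ : Fin 2) :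
    hubbardTorus 2 L 1 0 * momentumAnnihilation p τ =
      momentumAnnihilation p τ * hubbardTorus 2 L 1 0 -
        ((torusBand L p : ℝ) : ℂ) • momentumAnnihilation p τ := by
  rw [hubbardTorus_zero_eq_sum_momentumNumber hL]
  simp only [Finset.sum_mul, Finset.mul_sum, smul_mul_assoc, mul_smul_comm,
    momentumNumber_mul_momentumAnnihilation, smul_sub, Finset.sum_sub_distrib, ite_and, smul_ite,
    smul_zero, Finset.sum_ite_irrel, Finset.sum_const_zero, Finset.sum_ite_eq', Finset.mem_univ,
    if_true]

/-- The free band commuted past a creation operator: `H₀ c†_{qτ} = c†_{qτ} H₀ + ε_L(q) c†_{qτ}` (`L ≥ 3`).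
[folklore] -/
theorem hubbardTorus_zero_mul_momentumCreation (hL : 3 ≤ L) (q : TorusSite 2 L) (τ : Fin 2) :
    hubbardTorus 2 L 1 0 * momentumCreation q τ =
      momentumCreation q τ * hubbardTorus 2 L 1 0 +
        ((torusBand L q : ℝ) : ℂ) • momentumCreation q τ := by
  rw [hubbardTorus_zero_eq_sum_momentumNumber hL]
  simp only [Finset.sum_mul, Finset.mul_sum, smul_mul_assoc, mul_smul_comm,
    momentumNumber_mul_momentumCreation, smul_add, Finset.sum_add_distrib, ite_and, smul_ite,
    smul_zero, Finset.sum_ite_irrel, Finset.sum_const_zero, Finset.sum_ite_eq', Finset.mem_univ,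
    if_true]

/-- Adjoint bookkeeping: `⟨A v, w⟩ = ⟨v, Aᴴ w⟩`. [folklore] -/
private theorem star_mulVec_dotProduct_eq {ι : Type*} [Fintype ι] (A : Matrix ι ι ℂ) (v w : ι → ℂ) :
    star (A *ᵥ v) ⬝ᵥ w = star v ⬝ᵥ (Aᴴ *ᵥ w) := by
  rw [Matrix.star_mulVec, ← Matrix.dotProduct_mulVec]

/-! ### Vectors without down electrons -/

omit [NeZero L] in
/-- A vector of a sector `(a, 0)` has no down electrons. [folklore] -/
theorem noDown_of_isInSector_zero {a : ℕ} {φ : Fock (Orb (FermionTorus 2 L))} (h : IsInSector a 0 φ) :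
    ∀ (s : Finset (Orb (FermionTorus 2 L))) (y : FermionTorus 2 L), orb y 1 ∈ s → φ s = 0 := by
  intro s y hy
  refine h s fun hc => ?_
  have hy' : y ∈ downPart s := (mem_downPart s y).2 hy
  rw [Finset.card_eq_zero] at hc
  simp [hc.2] at hy'

omit [NeZero L] in
/-- `n_{y↓}` kills a vector without down electrons. [folklore] -/
theorem numberOp_down_mulVec_eq_zero {φ : Fock (Orb (FermionTorus 2 L))}
    (hφ : ∀ (s : Finset (Orb (FermionTorus 2 L))) (y : FermionTorus 2 L), orb y 1 ∈ s → φ s = 0)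
    (y : FermionTorus 2 L) : numberOp y 1 *ᵥ φ = 0 := by
  rw [numberOp, ← mulVec_mulVec, SsbToEvenTorusLro.Negative.annihilation_down_mulVec_eq_zero hφ,
    mulVec_zero]

omit [NeZero L] in
/-- The doublon number `Σ_x n_{x↑} n_{x↓}` kills a vector without down electrons ("a saturated
ferromagnet does not feel `U`", Tasaki 1998 §3.2). [folklore] -/
theorem doublon_mulVec_eq_zero {φ : Fock (Orb (FermionTorus 2 L))}
    (hφ : ∀ (s : Finset (Orb (FermionTorus 2 L))) (y : FermionTorus 2 L), orb y 1 ∈ s → φ s = 0) :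
    (∑ x : FermionTorus 2 L, numberOp x 0 * numberOp x 1) *ᵥ φ = 0 := by
  rw [Matrix.sum_mulVec]
  exact Finset.sum_eq_zero fun x _ => by
    rw [← mulVec_mulVec, numberOp_down_mulVec_eq_zero hφ, mulVec_zero]

/-- Every down Bloch annihilator kills a vector without down electrons. [folklore] -/
theorem momentumAnnihilation_down_mulVec_eq_zero {φ : Fock (Orb (FermionTorus 2 L))}
    (hφ : ∀ (s : Finset (Orb (FermionTorus 2 L))) (y : FermionTorus 2 L), orb y 1 ∈ s → φ s = 0)
    (k : TorusSite 2 L) : momentumAnnihilation k 1 *ᵥ φ = 0 := by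
  rw [momentumAnnihilation, Matrix.sum_mulVec]
  exact Finset.sum_eq_zero fun x _ => by
    rw [Matrix.smul_mulVec, SsbToEvenTorusLro.Negative.annihilation_down_mulVec_eq_zero hφ,
      smul_zero]

omit [NeZero L] in
/-- On a vector without down electrons the Hubbard Hamiltonian is the free band. [folklore] -/
theorem hubbardTorus_mulVec_of_noDown (U : ℝ) {φ : Fock (Orb (FermionTorus 2 L))}
    (hφ : ∀ (s : Finset (Orb (FermionTorus 2 L))) (y : FermionTorus 2 L), orb y 1 ∈ s → φ s = 0) :
    hubbardTorus 2 L 1 U *ᵥ φ = hubbardTorus 2 L 1 0 *ᵥ φ := by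
  -- `H(U) = H(0) + U · Σ_x n_{x↑} n_{x↓}` (tree: `WcbcsLegendre.hubbardTorus_eq_add_interaction`)
  have hsplit : hubbardTorus 2 L 1 U = hubbardTorus 2 L 1 0 +
      (U : ℂ) • ∑ x : FermionTorus 2 L, numberOp x 0 * numberOp x 1 := by
    simp only [hubbardTorus, hamiltonian, Complex.ofReal_zero, zero_smul, add_zero]
  rw [hsplit, add_mulVec, Matrix.smul_mulVec, doublon_mulVec_eq_zero hφ, smul_zero, add_zero]

/-- Up Bloch annihilators preserve the absence of down electrons. [folklore] -/
theorem noDown_momentumAnnihilation_up {φ : Fock (Orb (FermionTorus 2 L))}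
    (hφ : ∀ (s : Finset (Orb (FermionTorus 2 L))) (y : FermionTorus 2 L), orb y 1 ∈ s → φ s = 0)
    (p : TorusSite 2 L) :
    ∀ (s : Finset (Orb (FermionTorus 2 L))) (y : FermionTorus 2 L), orb y 1 ∈ s →
      (momentumAnnihilation p 0 *ᵥ φ) s = 0 := by
  intro s y hy
  rw [momentumAnnihilation, Matrix.sum_mulVec, Finset.sum_apply]
  refine Finset.sum_eq_zero fun x _ => ?_
  rw [Matrix.smul_mulVec, Pi.smul_apply,
    SsbToEvenTorusLro.Negative.annihilation_mulVec_noDown hφ _ s y hy, smul_zero]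

/-- `c_{p↑}` maps the sector `(m + 1, 0)` to `(m, 0)`. [folklore] -/
theorem isInSector_momentumAnnihilation_up {m : ℕ} {φ : Fock (Orb (FermionTorus 2 L))}
    (h : IsInSector (m + 1) 0 φ) (p : TorusSite 2 L) :
    IsInSector m 0 (momentumAnnihilation p 0 *ᵥ φ) := by
  rw [momentumAnnihilation, Matrix.sum_mulVec]
  exact IsInSector.sum fun x _ => by
    rw [Matrix.smul_mulVec]
    exact (h.annihilation_up_mulVec x).smul _

/-- `c†_{q↓}` maps the sector `(m, b)` to `(m, b + 1)`. [folklore] -/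
theorem isInSector_momentumCreation_down {m b : ℕ} {v : Fock (Orb (FermionTorus 2 L))}
    (h : IsInSector m b v) (q : TorusSite 2 L) :
    IsInSector m (b + 1) (momentumCreation q 1 *ᵥ v) := by
  rw [momentumCreation_eq_sum, Matrix.sum_mulVec]
  exact IsInSector.sum fun x _ => by
    rw [Matrix.smul_mulVec]
    exact (h.creation_down_mulVec x).smul _

/-! ### The flip state `χ = c†_{0↓} c_{p↑} φ` -/

/-- `‖c†_{q↓} v‖ = ‖v‖` for `v` without down electrons (`c_{q↓} v = 0` and the CAR). [folklore] -/
theorem star_flip_dotProduct_flip {v : Fock (Orb (FermionTorus 2 L))}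
    (hv : ∀ (s : Finset (Orb (FermionTorus 2 L))) (y : FermionTorus 2 L), orb y 1 ∈ s → v s = 0)
    (q : TorusSite 2 L) :
    star (momentumCreation q 1 *ᵥ v) ⬝ᵥ (momentumCreation q 1 *ᵥ v) = star v ⬝ᵥ v := by
  rw [star_mulVec_dotProduct_eq, momentumCreation_conjTranspose, mulVec_mulVec,
    momentumAnnihilation_mul_momentumCreation, if_pos ⟨rfl, rfl⟩, sub_mulVec, one_mulVec,
    ← mulVec_mulVec, momentumAnnihilation_down_mulVec_eq_zero hv, mulVec_zero, sub_zero]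

/-- `n_{y↓} c†_{0↓} v = L⁻¹ c†_{y↓} v` for `v` without down electrons: the delocalised down electron
seen at the site `y`. [folklore] -/
theorem numberOp_down_mulVec_flip {v : Fock (Orb (FermionTorus 2 L))}
    (hv : ∀ (s : Finset (Orb (FermionTorus 2 L))) (y : FermionTorus 2 L), orb y 1 ∈ s → v s = 0)
    (y : FermionTorus 2 L) :
    numberOp y 1 *ᵥ (momentumCreation 0 1 *ᵥ v) =
      torusFourierWeight 2 L • (creation (orb y 1) *ᵥ v) := by
  have hx : ∀ x : FermionTorus 2 L, numberOp y 1 *ᵥ (creation (orb x 1) *ᵥ v) =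
      if x = y then creation (orb x 1) *ᵥ v else 0 := by
    intro x
    have h := numberOp_commutator_creation y x 1 1
    rw [sub_eq_iff_eq_add] at h
    rw [mulVec_mulVec, h, add_mulVec, ← mulVec_mulVec, numberOp_down_mulVec_eq_zero hv, mulVec_zero,
      add_zero]
    simp only [true_and]
    split_ifs <;> simp
  rw [momentumCreation_eq_sum, Matrix.sum_mulVec, mulVec_sum]
  simp only [Matrix.smul_mulVec, mulVec_smul, hx, torusChar_zero_left, mul_one, smul_ite,
    smul_zero, Finset.sum_ite_eq', Finset.mem_univ, if_true]

/-- `c_{0↓} c†_{y↓} v = L⁻¹ v` for `v` without down electrons. [folklore] -/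
theorem momentumAnnihilation_down_mulVec_creation {v : Fock (Orb (FermionTorus 2 L))}
    (hv : ∀ (s : Finset (Orb (FermionTorus 2 L))) (y : FermionTorus 2 L), orb y 1 ∈ s → v s = 0)
    (y : FermionTorus 2 L) :
    momentumAnnihilation 0 1 *ᵥ (creation (orb y 1) *ᵥ v) = torusFourierWeight 2 L • v := by
  have hz : ∀ z : FermionTorus 2 L, annihilation (orb z 1) *ᵥ (creation (orb y 1) *ᵥ v) =
      if z = y then v else 0 := by
    intro z
    have h := annihilation_mul_creation_add_torus (orb z 1) (orb y 1)
    rw [← eq_sub_iff_add_eq] at h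
    rw [mulVec_mulVec, h, sub_mulVec, ← mulVec_mulVec,
      SsbToEvenTorusLro.Negative.annihilation_down_mulVec_eq_zero hv, mulVec_zero, sub_zero]
    by_cases hzy : z = y
    · subst hzy; simp
    · rw [if_neg (fun h' => hzy (orb_eq_orb_iff.1 h').1), zero_mulVec, if_neg hzy]
  rw [momentumAnnihilation, Matrix.sum_mulVec]
  simp only [Matrix.smul_mulVec, hz, torusChar_zero_left, map_one, mul_one, smul_ite,
    smul_zero, Finset.sum_ite_eq', Finset.mem_univ, if_true]

/-- `c_{0↓}` commutes with `n_{y↑}`. [folklore] -/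
theorem momentumAnnihilation_down_mul_numberOp_up (y : FermionTorus 2 L) :
    momentumAnnihilation (0 : TorusSite 2 L) 1 * numberOp y 0 = numberOp y 0 * momentumAnnihilation 0 1 := by
  rw [momentumAnnihilation, Finset.sum_mul, Finset.mul_sum]
  refine Finset.sum_congr rfl fun z _ => ?_
  rw [smul_mul_assoc, mul_smul_comm]
  congr 1
  have h := numberOp_commutator_annihilation y z 0 1
  simp only [Fin.one_eq_zero_iff, OfNat.ofNat_ne_one, false_and, if_false, neg_zero, sub_eq_zero] at h
  exact h.symm

/-- **Interaction energy of the flip state**: for `v` in the sector `(m, 0)`,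
`⟨c†_{0↓} v, (Σ_y n_{y↑} n_{y↓}) c†_{0↓} v⟩ = (m / L²) ‖v‖²` — a down electron in the `k = 0` Bloch
mode meets the uniform up density `m/L²` (Hartree, exact for this Slater-type state). [folklore] -/
theorem star_flip_dotProduct_doublon_flip {m : ℕ} {v : Fock (Orb (FermionTorus 2 L))}
    (hv : IsInSector m 0 v) :
    star (momentumCreation 0 1 *ᵥ v) ⬝ᵥ
        ((∑ y : FermionTorus 2 L, numberOp y 0 * numberOp y 1) *ᵥ (momentumCreation 0 1 *ᵥ v)) =
      ((m : ℂ) / (L : ℂ) ^ 2) * (star v ⬝ᵥ v) := by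
  have hv0 := noDown_of_isInSector_zero hv
  have hy : ∀ y : FermionTorus 2 L, star (momentumCreation 0 1 *ᵥ v) ⬝ᵥ
      ((numberOp y 0 * numberOp y 1) *ᵥ (momentumCreation 0 1 *ᵥ v)) =
        (torusFourierWeight 2 L * torusFourierWeight 2 L) * (star v ⬝ᵥ (numberOp y 0 *ᵥ v)) := by
    intro y
    rw [← mulVec_mulVec, numberOp_down_mulVec_flip hv0, mulVec_smul, dotProduct_smul,
      star_mulVec_dotProduct_eq, momentumCreation_conjTranspose, mulVec_mulVec,
      momentumAnnihilation_down_mul_numberOp_up, ← mulVec_mulVec,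
      momentumAnnihilation_down_mulVec_creation hv0, mulVec_smul, dotProduct_smul, smul_eq_mul,
      smul_eq_mul, mul_assoc]
  have hN : (∑ y : FermionTorus 2 L, numberOp y 0) *ᵥ v = (m : ℂ) • v := by
    have h1 : (∑ y : FermionTorus 2 L, numberOp y 0) *ᵥ v = totalNumber *ᵥ v := by
      rw [totalNumber, Matrix.sum_mulVec, Matrix.sum_mulVec]
      refine Finset.sum_congr rfl fun y _ => ?_
      rw [Fin.sum_univ_two, add_mulVec, numberOp_down_mulVec_eq_zero hv0, add_zero]
    rw [h1, totalNumber_mulVec_of_isNParticle hv.isNParticle, Nat.add_zero]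
  rw [Matrix.sum_mulVec, dotProduct_sum]
  simp only [hy]
  rw [← Finset.mul_sum, ← dotProduct_sum, ← Matrix.sum_mulVec, hN, dotProduct_smul, smul_eq_mul,
    torusFourierWeight_mul_self]
  ring

/-- **Kinetic energy of the flip state**: if `φ` (no down electrons) is an `H`-eigenvector,
`H φ = E φ`, then `H₀ (c†_{0↓} c_{p↑} φ) = (E - ε_L(p) - 4) · c†_{0↓} c_{p↑} φ` — remove the Bloch energy
`ε_L(p)`, add the band bottom `ε_L(0) = -4`. [folklore] -/
theorem hubbardTorus_zero_mulVec_flipState (hL : 3 ≤ L) (U E : ℝ) {φ : Fock (Orb (FermionTorus 2 L))}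
    (hφ : ∀ (s : Finset (Orb (FermionTorus 2 L))) (y : FermionTorus 2 L), orb y 1 ∈ s → φ s = 0)
    (hE : hubbardTorus 2 L 1 U *ᵥ φ = ((E : ℝ) : ℂ) • φ) (p : TorusSite 2 L) :
    hubbardTorus 2 L 1 0 *ᵥ (momentumCreation 0 1 *ᵥ (momentumAnnihilation p 0 *ᵥ φ)) =
      ((E - torusBand L p - 4 : ℝ) : ℂ) • (momentumCreation 0 1 *ᵥ (momentumAnnihilation p 0 *ᵥ φ)) := by
  have hE0 : hubbardTorus 2 L 1 0 *ᵥ φ = ((E : ℝ) : ℂ) • φ := by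
    rw [← hubbardTorus_mulVec_of_noDown U hφ, hE]
  have hv : hubbardTorus 2 L 1 0 *ᵥ (momentumAnnihilation p 0 *ᵥ φ) =
      ((E - torusBand L p : ℝ) : ℂ) • (momentumAnnihilation p 0 *ᵥ φ) := by
    rw [mulVec_mulVec, hubbardTorus_zero_mul_momentumAnnihilation hL, sub_mulVec, ← mulVec_mulVec, hE0,
      mulVec_smul, Matrix.smul_mulVec, ← sub_smul]
    push_cast
    rfl
  rw [mulVec_mulVec, hubbardTorus_zero_mul_momentumCreation hL, add_mulVec, ← mulVec_mulVec, hv,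
    mulVec_smul, Matrix.smul_mulVec, ← add_smul, torusBand_zero]
  push_cast
  ring_nf

/-- **Energy of the flip state.** For `φ` in the fully polarised sector `(m + 1, 0)` with
`H φ = E φ`: `Re⟨χ, H χ⟩ = (E - ε_L(p) - 4 + U m/L²) ‖c_{p↑} φ‖²` for `χ = c†_{0↓} c_{p↑} φ`
(`H = hubbardTorus 2 L 1 U`, `L ≥ 3`). Tasaki, Prog. Theor. Phys. 99 (1998) 489, §3.2 (single spin
flip), in Hartree form. [folklore] -/
theorem re_expect_flipState (hL : 3 ≤ L) (U E : ℝ) {m : ℕ} {φ : Fock (Orb (FermionTorus 2 L))}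
    (hφ : IsInSector (m + 1) 0 φ) (hE : hubbardTorus 2 L 1 U *ᵥ φ = ((E : ℝ) : ℂ) • φ) (p : TorusSite 2 L) :
    (star (momentumCreation 0 1 *ᵥ (momentumAnnihilation p 0 *ᵥ φ)) ⬝ᵥ
        (hubbardTorus 2 L 1 U *ᵥ (momentumCreation 0 1 *ᵥ (momentumAnnihilation p 0 *ᵥ φ)))).re =
      (E - torusBand L p - 4 + U * m / (L : ℝ) ^ 2) *
        (star (momentumAnnihilation p 0 *ᵥ φ) ⬝ᵥ (momentumAnnihilation p 0 *ᵥ φ)).re := by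
  have hφ0 := noDown_of_isInSector_zero hφ
  have hv : IsInSector m 0 (momentumAnnihilation p 0 *ᵥ φ) := isInSector_momentumAnnihilation_up hφ p
  have hv0 := noDown_of_isInSector_zero hv
  have hsplit : hubbardTorus 2 L 1 U = hubbardTorus 2 L 1 0 +
      (U : ℂ) • ∑ x : FermionTorus 2 L, numberOp x 0 * numberOp x 1 := by
    simp only [hubbardTorus, hamiltonian, Complex.ofReal_zero, zero_smul, add_zero]
  rw [hsplit, add_mulVec, Matrix.smul_mulVec, dotProduct_add, dotProduct_smul,
    hubbardTorus_zero_mulVec_flipState hL U E hφ0 hE p, dotProduct_smul, star_flip_dotProduct_flip hv0,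
    star_flip_dotProduct_doublon_flip hv, smul_eq_mul, smul_eq_mul, Complex.add_re,
    Complex.re_ofReal_mul]
  have hc : ((U : ℂ) * ((m : ℂ) / (L : ℂ) ^ 2 *
      (star (momentumAnnihilation p 0 *ᵥ φ) ⬝ᵥ (momentumAnnihilation p 0 *ᵥ φ)))).re =
        U * m / (L : ℝ) ^ 2 * (star (momentumAnnihilation p 0 *ᵥ φ) ⬝ᵥ (momentumAnnihilation p 0 *ᵥ φ)).re := by
    rw [← mul_assoc, show (U : ℂ) * ((m : ℂ) / (L : ℂ) ^ 2) = ((U * m / (L : ℝ) ^ 2 : ℝ) : ℂ) by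
      push_cast; ring, Complex.re_ofReal_mul]
  rw [hc]
  ring

/-- **Variational consequence**: with `φ`, `E`, `p` as above and `c_{p↑} φ ≠ 0`, the sector energy of
`(m, 1)` — i.e. `szSector (m + 1) ((m - 1)/2)` — is at most `E - ε_L(p) - 4 + U m/L²`. [folklore] -/
theorem minEnergyOn_flipSector_le (hL : 3 ≤ L) (U E : ℝ) {m : ℕ} (hm : m ≤ L ^ 2)
    {φ : Fock (Orb (FermionTorus 2 L))} (hφ : IsInSector (m + 1) 0 φ)
    (hE : hubbardTorus 2 L 1 U *ᵥ φ = ((E : ℝ) : ℂ) • φ) {p : TorusSite 2 L}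
    (hp : momentumAnnihilation p 0 *ᵥ φ ≠ 0) :
    (hubbardTorus 2 L 1 U).minEnergyOn (szSector (m + 1) (((m : ℝ) - 1) / 2)) ≤
      E - torusBand L p - 4 + U * m / (L : ℝ) ^ 2 := by
  have hv : IsInSector m 0 (momentumAnnihilation p 0 *ᵥ φ) := isInSector_momentumAnnihilation_up hφ p
  have hχ : IsInSector m 1 (momentumCreation 0 1 *ᵥ (momentumAnnihilation p 0 *ᵥ φ)) := by
    simpa using isInSector_momentumCreation_down hv 0
  have hcard : Fintype.card (FermionTorus 2 L) = L ^ 2 := by simp [FermionTorus, Fintype.card_fin]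
  have hmc : m ≤ Fintype.card (FermionTorus 2 L) := by rwa [hcard]
  have h1c : 1 ≤ Fintype.card (FermionTorus 2 L) := by
    rw [hcard]; exact Nat.one_le_pow _ _ (by omega)
  have hb := (upDownSector_groundState (fermionTorusGraph 2 L) 1 U hmc h1c).2 _ hχ
  rw [Nat.cast_one, Literature.MathematicalPhysics.QuantumLattice.expect, show hamiltonian (fermionTorusGraph 2 L) 1 U = hubbardTorus 2 L 1 U from rfl,
    re_expect_flipState hL U E hφ hE p, star_flip_dotProduct_flip (noDown_of_isInSector_zero hv)] at hb
  have hpos : 0 < (star (momentumAnnihilation p 0 *ᵥ φ) ⬝ᵥ (momentumAnnihilation p 0 *ᵥ φ)).re :=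
    (Complex.pos_iff.1 (dotProduct_star_self_pos_iff.2 hp)).1
  exact le_of_mul_le_mul_right hb hpos

end Summit.HubbardSuperconductivity.HubbardSuperconductivity.Theorems.MesoscopicPairOrder.Negative
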